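/-
Copyright (c) 2026 the pub-hodgecm-mathlib formalisation cell (harness21).  Prover seat hodgecm-mathlib-K2E1-p13 (g6), Track B ∕ K2-LIT, h413 = `stmt-HodgeConjecture-24833`,
R90-TF section S8 «ContSpec-n½», S8 dealer R90-CS-plan (g4) S8-R298 (1)(3) «the (β) row»: the shifted archimedean section `Φ^{p,q} = archSectionShifted χ₁ χ₂ p q` is
`K_∞`-FINITE — the span of its right `K_∞`-translates is finite-dimensional — which is EXACTLY the `hΦ` binder of ★ K2E1-p14 `isArchFinite_archFin_of_finiteDimensional`
(`R90S8ResGMidAtomTauLawsKMaxU3`), so every section `g ↦ Φ^{p,q}(g_∞)·Φf(g_f)` is arch-finite (the (V-τ) `IsArchFinite` instance).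
-/
import Summits.HodgeConjecture.HodgeConjecture.Theorems.R90S8ChiSectionPairArchSectionShiftedU3   -- ★ (this seat) (∞-2)(β): `extensionEmbedding_archLastRowS_fst`, `…L_fst`, `…L_fst_ne_zero`; brings ★ Shifted DEFS
import Summits.HodgeConjecture.HodgeConjecture.Theorems.R90S8ChiSectionPairLevelOfRecordU3       -- ★ K2E1-p11 3d: `evalC_map_mul_antidiagonal_eq`, `evalC_apply_centro`, `archLastRowL_mul_of_mem`, `archSectionE_mul_of_mem`
import Summits.HodgeConjecture.HodgeConjecture.Theorems.R90S8ResGMidAtomTauLawsKMaxU3            -- ★ K2E1-p14: `isArchFinite_archFin_of_finiteDimensional` (the L-shift reduction)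
import Mathlib.LinearAlgebra.FiniteDimensional.Basic                                              -- Mathlib `Submodule.finiteDimensional_of_le`
import Mathlib.RingTheory.Finiteness.Basic                                                        -- Mathlib `Submodule.FG.mul`, `Submodule.FG.pow`, `Submodule.fg_span`
import HarnessLib

/-!
# S8 (∞-2)(β) — `R90S8ArchSectionShiftedKFiniteU3`: THE SHIFTED ARCHIMEDEAN SECTION IS `K_∞`-FINITE

Track B ∕ K2-LIT, crux h413 = `stmt-HodgeConjecture-24833`, route of record `HCCMUnconditional`; cell `hodgecm-mathlib`, R90-TF programme, section S8 «ContSpec-n½», road R2-χ₃, (V-τ)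
row.  ★ K2E1-p14's L-SHIFT `isArchFinite_archFin_of_finiteDimensional Φ Φf hΦ` reduces the arch-finiteness of a section `g ↦ Φ(g_∞)·Φf(g_f)` to ONE binder
`hΦ : FiniteDimensional ℂ (span ℂ {x ↦ Φ(x·a) | ι(a) ∈ K})`; this file PAYS `hΦ` for `Φ := archSectionShifted χ₁ χ₂ p q` (every `χ₁, χ₂, p, q`), and hence the instance
`IsArchFinite (g ↦ Φ^{p,q}(g_∞)·Φf(g_f))` for every finite factor `Φf`.

THE MATHEMATICS ([BorelJacquet1979, §1.3, §4.1]; [Rogawski1990, §1.9–§1.10]; [MoeglinWaldspurger1995, I.2.17]).  Write, at a complex place `w` and for `a ∈ G_∞ = U(J₃)(L ⊗ ℝ)` with last row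
`(x₀, x₁, x₂)_w`, `ℓ = x₂ − x₀`, `𝓈 = x₂ + x₀`, `m = x₁`, and `F_w := 𝓈_w ∕ ℓ_w`, `G_w := x₁,w ∕ ℓ_w` (read in `ℂ` through `ι_w`).  For `k` with `ι(k) ∈ K` the matrix `k_w` is unitary and
commutes with `J₃` (★ `evalC_map_mul_antidiagonal_eq`), i.e. it is CENTRO-SYMMETRIC: `k₁₂ = k₁₀`, `k₀₂ = k₂₀`, `k₀₀ = k₂₂` (★ `evalC_apply_centro`) and `k₂₁ = k₀₁` (§1).  Reading the
last row of `a·k`: `ℓ(ak) = ℓ(a)ℓ(k)` (★ `archLastRowL_mul_of_mem`), `𝓈(ak) = 𝓈(a)(k₂₂ + k₂₀) + 2 m(a) k₁₀`, `m(ak) = 𝓈(a) k₀₁ + m(a) k₁₁` (§1), so the right translate by `k` maps the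
plane `U_w := ⟨F_w, G_w⟩` into itself, likewise its conjugate `Ū_w`, and the line `⟨Φa⟩` of the section of record (`Φa(ak) = Φa(a)Φa(k)`, ★ `archSectionE_mul_of_mem`) (§2–§3).  Right
translation by `k` is an algebra endomorphism of the function algebra, so the finitely generated submodule `W := (∏_w U_w^{p_w}·Ū_w^{q_w})·⟨Φa⟩` is `K_∞`-stable (§2); it contains
`Φ^{p,q} = ∏_w F_w^{p_w} F̄_w^{q_w} · Φa` (★ `archShiftFactor_def`, `archSectionShifted_def`), hence all its `K_∞`-translates, and is finite-dimensional (§4) — `Φ^{p,q}` is a `K_∞`-finite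
vector (it lies in the sum of the `K_w`-types `H^{p′,q′}(V₊) ⊗ (ℓ∕|ℓ|)^{a}`, `p′ ≤ p_w`, `q′ ≤ q_w`, of the induced representation).
* §1 `exists_archLastRow_laws_of_mem` (the two last-row laws), `exists_shiftRatio_laws_of_mem`, `exists_shiftRatio_conj_laws_of_mem` (the plane `⟨F_w, G_w⟩` and its conjugate are stable).
* §2 generic closure lemmas for the right-translation operator `f ↦ (x ↦ f(x·k))` on `Submodule ℂ (G → ℂ)`: span of a stable pair ∕ singleton, `*`, `^`, `∏`; `FG` of `∏`.
* §4 HEAD **`finiteDimensional_span_archTranslates_archSectionShifted χ₁ χ₂ p q`** = the `hΦ` binder of ★ `isArchFinite_archFin_of_finiteDimensional` at `Φ := archSectionShifted χ₁ χ₂ p q`,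
  byte for byte; corollary **`isArchFinite_archSectionShifted_archFin χ₁ χ₂ p q Φf`**.
HONEST LABEL: HC_CM is proved only modulo the 7 printed citations (2 remaining named inputs: hLiu418 = `stmt-HodgeConjecture-24832`, h413 = `stmt-HodgeConjecture-24833`) until rung 0
closes; this file pays ONE binder (`hΦ` ∕ the (V-τ) `IsArchFinite` instance) and closes no socket by itself; REL ≠ ★ ≠ BUILT; count-neutral.

## References
* [BorelJacquet1979] A. Borel, H. Jacquet, *Automorphic forms and automorphic representations*, Proc. Symp. Pure Math. 33.1 (1979), §1.3 (`K`-finite functions), §4.1.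
* [Rogawski1990] J. D. Rogawski, *Automorphic Representations of Unitary Groups in Three Variables* (1990), §1.9–§1.10.
* [MoeglinWaldspurger1995] C. Mœglin, J.-L. Waldspurger, *Spectral Decomposition and Eisenstein Series* (1995), I.2.17 (`K`-finite induced sections).
-/

set_option autoImplicit false
set_option linter.dupNamespace false  -- the mandated namespace `…HodgeConjecture.HodgeConjecture.R90.S8` repeats the summit's segment

noncomputable section

open NumberField ComplexConjugate
open scoped Matrix
open Literature.NumberTheory.Automorphic Literature.NumberTheory.Automorphic.UnitaryGroup Literature.NumberTheory.GaloisRepresentations AdelicGroupData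
open Literature.NumberTheory.Automorphic.Arthur2013.Leaves.TECR

namespace Summit.HodgeConjecture.HodgeConjecture.R90.S8

variable (L : Type) [Field L] [NumberField L] [IsCMField L]

/-! ## §1 The last-row laws along `K_∞`: `𝓈(ak) = 𝓈(a)(k₂₂ + k₂₀) + 2 m(a) k₁₀`, `m(ak) = 𝓈(a) k₀₁ + m(a) k₁₁` -/

/-- **The two last-row laws along `K_∞`.**  For `k ∈ G_∞` with `ι(k) ∈ K` there are constants `c₁ = k₂₂ + k₂₀`, `c₂ = 2k₁₀`, `d₁ = k₀₁`, `d₂ = k₁₁` (entries of `k_w`) with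
`ι_w 𝓈(a·k)_w = c₁·ι_w 𝓈(a)_w + c₂·ι_w (x₁(a))_w` and `ι_w (x₁(a·k))_w = d₁·ι_w 𝓈(a)_w + d₂·ι_w (x₁(a))_w` for every `a ∈ G_∞` — the last row of `a·k` is `(last row of a)·k_w`, and `k_w` is
centro-symmetric (`k₁₂ = k₁₀`, `k₀₂ = k₂₀`, `k₀₀ = k₂₂` ★ `evalC_apply_centro`, `k₂₁ = k₀₁` from `k_w J₃ = J₃ k_w` ★ `evalC_map_mul_antidiagonal_eq`). [cite: Rogawski1990, §1.9–§1.10] -/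
theorem exists_archLastRow_laws_of_mem (k : arch (↥(maximalRealSubfield L)) L (IsCMField.complexConj L) 3 ((StdForm.antidiagonal 3).over L))
    (hk : adelicVal (↥(maximalRealSubfield L)) L (IsCMField.complexConj L) 3 ((StdForm.antidiagonal 3).over L)
      (archToAdelic (↥(maximalRealSubfield L)) L (IsCMField.complexConj L) 3 ((StdForm.antidiagonal 3).over L) k) ∈ standardMaximalCompactGL 3 L) (w : InfinitePlace L) :
    ∃ c₁ c₂ d₁ d₂ : ℂ, ∀ a : arch (↥(maximalRealSubfield L)) L (IsCMField.complexConj L) 3 ((StdForm.antidiagonal 3).over L),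
      InfinitePlace.Completion.extensionEmbedding w ((archLastRowS L (a * k)).1 w) =
          c₁ * InfinitePlace.Completion.extensionEmbedding w ((archLastRowS L a).1 w) + c₂ * InfinitePlace.Completion.extensionEmbedding w ((archLastRow L a 1).1 w) ∧
        InfinitePlace.Completion.extensionEmbedding w ((archLastRow L (a * k) 1).1 w) =
          d₁ * InfinitePlace.Completion.extensionEmbedding w ((archLastRowS L a).1 w) + d₂ * InfinitePlace.Completion.extensionEmbedding w ((archLastRow L a 1).1 w) := by
  set M : Matrix (Fin 3) (Fin 3) ℂ := ((k : GL (Fin 3) (mixedEmbedding.mixedSpace L)) : Matrix (Fin 3) (Fin 3) (mixedEmbedding.mixedSpace L)).map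
    (evalC L ⟨w, IsTotallyComplex.isComplex w⟩) with hM
  obtain ⟨h12, h02, h00⟩ := evalC_apply_centro L k hk w
  change M 1 2 = M 1 0 at h12
  change M 0 2 = M 2 0 at h02
  change M 0 0 = M 2 2 at h00
  have h21 : M 2 1 = M 0 1 := by
    have hcomm := evalC_map_mul_antidiagonal_eq L k hk w
    rw [← hM] at hcomm
    have h := congrFun (congrFun hcomm 2) 1
    simp only [Matrix.mul_apply, Fin.sum_univ_three, antidiagonal_three_over_apply] at h
    simpa [Fin.rev, Fin.ext_iff] using h
  refine ⟨M 2 2 + M 2 0, 2 * M 1 0, M 0 1, M 1 1, fun a => ?_⟩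
  set A : Matrix (Fin 3) (Fin 3) ℂ := ((a : GL (Fin 3) (mixedEmbedding.mixedSpace L)) : Matrix (Fin 3) (Fin 3) (mixedEmbedding.mixedSpace L)).map
    (evalC L ⟨w, IsTotallyComplex.isComplex w⟩) with hA
  have hAM : ∀ i j, evalC L ⟨w, IsTotallyComplex.isComplex w⟩
      ((((a * k : arch (↥(maximalRealSubfield L)) L (IsCMField.complexConj L) 3 ((StdForm.antidiagonal 3).over L)) : GL (Fin 3) (mixedEmbedding.mixedSpace L)) :
        Matrix (Fin 3) (Fin 3) (mixedEmbedding.mixedSpace L)) i j) = (A * M) i j := fun i j => by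
    rw [hA, hM, ← Matrix.map_mul, Matrix.map_apply]
    rfl
  have hAij : ∀ j, evalC L ⟨w, IsTotallyComplex.isComplex w⟩ (((a : GL (Fin 3) (mixedEmbedding.mixedSpace L)) : Matrix (Fin 3) (Fin 3) (mixedEmbedding.mixedSpace L)) 2 j) = A 2 j :=
    fun j => rfl
  rw [extensionEmbedding_archLastRowS_fst, extensionEmbedding_archLastRowS_fst, extensionEmbedding_archLastRow_fst, extensionEmbedding_archLastRow_fst,
    hAM, hAM, hAM, hAij, hAij, hAij]
  simp only [Matrix.mul_apply, Fin.sum_univ_three]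
  exact ⟨by linear_combination (A 2 0) * h02 + (A 2 1) * h12 + (A 2 0) * h00, by linear_combination (A 2 2) * h21⟩

/-- **The plane `U_w = ⟨F_w, G_w⟩` is `K_∞`-stable**: with `F_w(a) := ι_w 𝓈(a)_w ∕ ι_w ℓ(a)_w` and `G_w(a) := ι_w (x₁(a))_w ∕ ι_w ℓ(a)_w` (`ℓ_w ≠ 0` on `G_∞`, ★ `extensionEmbedding_archLastRowL_fst_ne_zero`),
`F_w(a·k) = α F_w(a) + β G_w(a)` and `G_w(a·k) = γ F_w(a) + δ G_w(a)` for constants `α, β, γ, δ` (`= c₁∕ℓ(k)_w, …`, §1 and `ℓ(ak) = ℓ(a)ℓ(k)` ★ `archLastRowL_mul_of_mem`). [cite: Rogawski1990, §1.10] -/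
theorem exists_shiftRatio_laws_of_mem (k : arch (↥(maximalRealSubfield L)) L (IsCMField.complexConj L) 3 ((StdForm.antidiagonal 3).over L))
    (hk : adelicVal (↥(maximalRealSubfield L)) L (IsCMField.complexConj L) 3 ((StdForm.antidiagonal 3).over L)
      (archToAdelic (↥(maximalRealSubfield L)) L (IsCMField.complexConj L) 3 ((StdForm.antidiagonal 3).over L) k) ∈ standardMaximalCompactGL 3 L) (w : InfinitePlace L) :
    ∃ α β γ δ : ℂ,
      (∀ a : arch (↥(maximalRealSubfield L)) L (IsCMField.complexConj L) 3 ((StdForm.antidiagonal 3).over L),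
        InfinitePlace.Completion.extensionEmbedding w ((archLastRowS L (a * k)).1 w) / InfinitePlace.Completion.extensionEmbedding w ((archLastRowL L (a * k)).1 w) =
          α * (InfinitePlace.Completion.extensionEmbedding w ((archLastRowS L a).1 w) / InfinitePlace.Completion.extensionEmbedding w ((archLastRowL L a).1 w)) +
            β * (InfinitePlace.Completion.extensionEmbedding w ((archLastRow L a 1).1 w) / InfinitePlace.Completion.extensionEmbedding w ((archLastRowL L a).1 w))) ∧
      (∀ a : arch (↥(maximalRealSubfield L)) L (IsCMField.complexConj L) 3 ((StdForm.antidiagonal 3).over L),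
        InfinitePlace.Completion.extensionEmbedding w ((archLastRow L (a * k) 1).1 w) / InfinitePlace.Completion.extensionEmbedding w ((archLastRowL L (a * k)).1 w) =
          γ * (InfinitePlace.Completion.extensionEmbedding w ((archLastRowS L a).1 w) / InfinitePlace.Completion.extensionEmbedding w ((archLastRowL L a).1 w)) +
            δ * (InfinitePlace.Completion.extensionEmbedding w ((archLastRow L a 1).1 w) / InfinitePlace.Completion.extensionEmbedding w ((archLastRowL L a).1 w))) := by
  obtain ⟨c₁, c₂, d₁, d₂, h⟩ := exists_archLastRow_laws_of_mem L k hk w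
  have hl : ∀ a : arch (↥(maximalRealSubfield L)) L (IsCMField.complexConj L) 3 ((StdForm.antidiagonal 3).over L),
      InfinitePlace.Completion.extensionEmbedding w ((archLastRowL L (a * k)).1 w) =
        InfinitePlace.Completion.extensionEmbedding w ((archLastRowL L a).1 w) * InfinitePlace.Completion.extensionEmbedding w ((archLastRowL L k).1 w) := fun a => by
    have hmul : ((archLastRowL L a * archLastRowL L k).1 w) = (archLastRowL L a).1 w * (archLastRowL L k).1 w := rfl
    rw [archLastRowL_mul_of_mem L a k hk, hmul, map_mul]
  have hk0 := extensionEmbedding_archLastRowL_fst_ne_zero L k w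
  refine ⟨c₁ / InfinitePlace.Completion.extensionEmbedding w ((archLastRowL L k).1 w), c₂ / InfinitePlace.Completion.extensionEmbedding w ((archLastRowL L k).1 w),
    d₁ / InfinitePlace.Completion.extensionEmbedding w ((archLastRowL L k).1 w), d₂ / InfinitePlace.Completion.extensionEmbedding w ((archLastRowL L k).1 w),
    fun a => ?_, fun a => ?_⟩
  · have ha0 := extensionEmbedding_archLastRowL_fst_ne_zero L a w
    rw [(h a).1, hl a]
    field_simp
  · have ha0 := extensionEmbedding_archLastRowL_fst_ne_zero L a w
    rw [(h a).2, hl a]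
    field_simp

/-- **The conjugate plane `Ū_w = ⟨F̄_w, Ḡ_w⟩` is `K_∞`-stable** (conjugate the laws of `exists_shiftRatio_laws_of_mem`; `conj` is a field automorphism). [cite: Rogawski1990, §1.10] -/
theorem exists_shiftRatio_conj_laws_of_mem (k : arch (↥(maximalRealSubfield L)) L (IsCMField.complexConj L) 3 ((StdForm.antidiagonal 3).over L))
    (hk : adelicVal (↥(maximalRealSubfield L)) L (IsCMField.complexConj L) 3 ((StdForm.antidiagonal 3).over L)
      (archToAdelic (↥(maximalRealSubfield L)) L (IsCMField.complexConj L) 3 ((StdForm.antidiagonal 3).over L) k) ∈ standardMaximalCompactGL 3 L) (w : InfinitePlace L) :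
    ∃ α β γ δ : ℂ,
      (∀ a : arch (↥(maximalRealSubfield L)) L (IsCMField.complexConj L) 3 ((StdForm.antidiagonal 3).over L),
        conj (InfinitePlace.Completion.extensionEmbedding w ((archLastRowS L (a * k)).1 w)) / conj (InfinitePlace.Completion.extensionEmbedding w ((archLastRowL L (a * k)).1 w)) =
          α * (conj (InfinitePlace.Completion.extensionEmbedding w ((archLastRowS L a).1 w)) / conj (InfinitePlace.Completion.extensionEmbedding w ((archLastRowL L a).1 w))) +
            β * (conj (InfinitePlace.Completion.extensionEmbedding w ((archLastRow L a 1).1 w)) / conj (InfinitePlace.Completion.extensionEmbedding w ((archLastRowL L a).1 w)))) ∧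
      (∀ a : arch (↥(maximalRealSubfield L)) L (IsCMField.complexConj L) 3 ((StdForm.antidiagonal 3).over L),
        conj (InfinitePlace.Completion.extensionEmbedding w ((archLastRow L (a * k) 1).1 w)) / conj (InfinitePlace.Completion.extensionEmbedding w ((archLastRowL L (a * k)).1 w)) =
          γ * (conj (InfinitePlace.Completion.extensionEmbedding w ((archLastRowS L a).1 w)) / conj (InfinitePlace.Completion.extensionEmbedding w ((archLastRowL L a).1 w))) +
            δ * (conj (InfinitePlace.Completion.extensionEmbedding w ((archLastRow L a 1).1 w)) / conj (InfinitePlace.Completion.extensionEmbedding w ((archLastRowL L a).1 w)))) := by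
  obtain ⟨α, β, γ, δ, hF, hG⟩ := exists_shiftRatio_laws_of_mem L k hk w
  refine ⟨conj α, conj β, conj γ, conj δ, fun a => ?_, fun a => ?_⟩
  · simp only [← map_div₀, hF a, map_add, map_mul]
  · simp only [← map_div₀, hG a, map_add, map_mul]

/-! ## §2 Generic closure lemmas for the right-translation operator `f ↦ (x ↦ f(x·k))` on submodules of a function algebra `G → ℂ` -/

/-- A plane `⟨F, G⟩` whose generators transform into the plane under `x ↦ x·k` is stable under right translation by `k`. [cite: BorelJacquet1979, §1.3] -/
theorem precomp_mem_span_pair_of_laws {G : Type*} [Mul G] (k : G) (F₁ F₂ : G → ℂ) {α β γ δ : ℂ}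
    (h₁ : ∀ a, F₁ (a * k) = α * F₁ a + β * F₂ a) (h₂ : ∀ a, F₂ (a * k) = γ * F₁ a + δ * F₂ a)
    {f : G → ℂ} (hf : f ∈ Submodule.span ℂ ({F₁, F₂} : Set (G → ℂ))) :
    (fun x => f (x * k)) ∈ Submodule.span ℂ ({F₁, F₂} : Set (G → ℂ)) := by
  obtain ⟨c, d, rfl⟩ := Submodule.mem_span_pair.1 hf
  refine Submodule.mem_span_pair.2 ⟨c * α + d * γ, c * β + d * δ, ?_⟩
  funext x
  simp only [Pi.add_apply, Pi.smul_apply, smul_eq_mul, h₁, h₂]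
  ring

/-- A line `⟨Φ⟩` with `Φ(a·k) = Φ(a)Φ(k)` is stable under right translation by `k`. [cite: BorelJacquet1979, §1.3] -/
theorem precomp_mem_span_singleton_of_mul {G : Type*} [Mul G] (k : G) (Φ : G → ℂ) (hΦ : ∀ a, Φ (a * k) = Φ a * Φ k)
    {f : G → ℂ} (hf : f ∈ Submodule.span ℂ ({Φ} : Set (G → ℂ))) :
    (fun x => f (x * k)) ∈ Submodule.span ℂ ({Φ} : Set (G → ℂ)) := by
  obtain ⟨c, rfl⟩ := Submodule.mem_span_singleton.1 hf
  refine Submodule.mem_span_singleton.2 ⟨c * Φ k, ?_⟩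
  funext x
  simp only [Pi.smul_apply, smul_eq_mul, hΦ]
  ring

/-- Right translation (an algebra endomorphism of `G → ℂ`) preserves a product `S·T` of stable submodules. [cite: BorelJacquet1979, §1.3] -/
theorem precomp_mem_mul_of_forall {G : Type*} [Mul G] (k : G) {S T : Submodule ℂ (G → ℂ)}
    (hS : ∀ f ∈ S, (fun x => f (x * k)) ∈ S) (hT : ∀ f ∈ T, (fun x => f (x * k)) ∈ T) :
    ∀ f ∈ S * T, (fun x => f (x * k)) ∈ S * T := fun f hf => by
  refine Submodule.mul_induction_on hf (fun m hm n hn => ?_) (fun u v hu hv => ?_)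
  · exact Submodule.mul_mem_mul (hS m hm) (hT n hn)
  · exact Submodule.add_mem _ hu hv

/-- Right translation preserves the powers `S ^ n` of a stable submodule. [cite: BorelJacquet1979, §1.3] -/
theorem precomp_mem_pow_of_forall {G : Type*} [Mul G] (k : G) {S : Submodule ℂ (G → ℂ)} (hS : ∀ f ∈ S, (fun x => f (x * k)) ∈ S) :
    ∀ n : ℕ, ∀ f ∈ S ^ n, (fun x => f (x * k)) ∈ S ^ n
  | 0 => fun f hf => by
      rw [pow_zero] at hf ⊢
      obtain ⟨r, rfl⟩ := Submodule.mem_one.1 hf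
      exact Submodule.mem_one.2 ⟨r, rfl⟩
  | n + 1 => fun f hf => by
      rw [pow_succ] at hf ⊢
      exact precomp_mem_mul_of_forall k (precomp_mem_pow_of_forall k hS n) hS f hf

/-- Right translation preserves a finite product `∏_{i ∈ s} M i` of stable submodules. [cite: BorelJacquet1979, §1.3] -/
theorem precomp_mem_finset_prod_of_forall {G ι : Type*} [Mul G] (k : G) (s : Finset ι) (M : ι → Submodule ℂ (G → ℂ))
    (h : ∀ i ∈ s, ∀ f ∈ M i, (fun x => f (x * k)) ∈ M i) : ∀ f ∈ ∏ i ∈ s, M i, (fun x => f (x * k)) ∈ ∏ i ∈ s, M i := by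
  classical
  induction s using Finset.induction_on with
  | empty =>
    intro f hf
    rw [Finset.prod_empty] at hf ⊢
    obtain ⟨r, rfl⟩ := Submodule.mem_one.1 hf
    exact Submodule.mem_one.2 ⟨r, rfl⟩
  | insert a s ha ih =>
    intro f hf
    rw [Finset.prod_insert ha] at hf ⊢
    exact precomp_mem_mul_of_forall k (h a (Finset.mem_insert_self a s)) (ih fun i hi => h i (Finset.mem_insert_of_mem hi)) f hf

/-- Products of elements lie in the product submodule. [folklore] -/
theorem finset_prod_mem_finset_prod {G ι : Type*} (s : Finset ι) (M : ι → Submodule ℂ (G → ℂ)) {f : ι → G → ℂ} (h : ∀ i ∈ s, f i ∈ M i) :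
    (∏ i ∈ s, f i) ∈ ∏ i ∈ s, M i := by
  classical
  induction s using Finset.induction_on with
  | empty =>
    rw [Finset.prod_empty, Finset.prod_empty]
    exact Submodule.mem_one.2 ⟨1, map_one _⟩
  | insert a s ha ih =>
    rw [Finset.prod_insert ha, Finset.prod_insert ha]
    exact Submodule.mul_mem_mul (h a (Finset.mem_insert_self a s)) (ih fun i hi => h i (Finset.mem_insert_of_mem hi))

/-- A finite product of finitely generated submodules is finitely generated. [folklore] -/
theorem fg_finset_prod {G ι : Type*} (s : Finset ι) (M : ι → Submodule ℂ (G → ℂ)) (h : ∀ i ∈ s, (M i).FG) : (∏ i ∈ s, M i).FG := by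
  classical
  induction s using Finset.induction_on with
  | empty =>
    rw [Finset.prod_empty, Submodule.one_eq_span]
    exact Submodule.fg_span (Set.finite_singleton _)
  | insert a s ha ih =>
    rw [Finset.prod_insert ha]
    exact (h a (Finset.mem_insert_self a s)).mul (ih fun i hi => h i (Finset.mem_insert_of_mem hi))

/-! ## §4 HEAD — the `K_∞`-translates of `Φ^{p,q}` span a finite-dimensional space; the (V-τ) `IsArchFinite` instance -/

/-- **(β) ROW — `archSectionShifted χ₁ χ₂ p q` IS `K_∞`-FINITE**: the span of the right `K_∞`-translates `{x ↦ Φ^{p,q}(x·a) | ι(a) ∈ K}` is finite-dimensional — the `hΦ` binder of ★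
`isArchFinite_archFin_of_finiteDimensional`, byte for byte.  Proof: the finitely generated submodule `W = (∏_w ⟨F_w,G_w⟩^{p_w}·⟨F̄_w,Ḡ_w⟩^{q_w})·⟨Φa⟩` of `G_∞ → ℂ` is `K_∞`-stable (§1–§2)
and contains `Φ^{p,q} = ∏_w F_w^{p_w}F̄_w^{q_w}·Φa`. [cite: BorelJacquet1979, §1.3, §4.1] [cite: Rogawski1990, §1.10] [cite: MoeglinWaldspurger1995, I.2.17] -/
theorem finiteDimensional_span_archTranslates_archSectionShifted (χ₁ : HeckeCharacter L) (χ₂ : ↥(TorusDict.torus (IsCMField.complexConj L)) →ₜ* ℂˣ)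
    (p q : InfinitePlace L → ℕ) :
    FiniteDimensional ℂ ↥(Submodule.span ℂ (Set.range fun a : {a : ↥(arch (↥(maximalRealSubfield L)) L (IsCMField.complexConj L) 3 ((StdForm.antidiagonal 3).over L)) //
        adelicVal (↥(maximalRealSubfield L)) L (IsCMField.complexConj L) 3 ((StdForm.antidiagonal 3).over L)
          (archToAdelic (↥(maximalRealSubfield L)) L (IsCMField.complexConj L) 3 ((StdForm.antidiagonal 3).over L) a) ∈ standardMaximalCompactGL 3 L} =>
      fun x : ↥(arch (↥(maximalRealSubfield L)) L (IsCMField.complexConj L) 3 ((StdForm.antidiagonal 3).over L)) =>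
        archSectionShifted L χ₁ χ₂ p q (x * (a : ↥(arch (↥(maximalRealSubfield L)) L (IsCMField.complexConj L) 3 ((StdForm.antidiagonal 3).over L)))))) := by
  classical
  -- the generators, place by place
  let F : InfinitePlace L → ↥(arch (↥(maximalRealSubfield L)) L (IsCMField.complexConj L) 3 ((StdForm.antidiagonal 3).over L)) → ℂ := fun w a =>
    InfinitePlace.Completion.extensionEmbedding w ((archLastRowS L a).1 w) / InfinitePlace.Completion.extensionEmbedding w ((archLastRowL L a).1 w)
  let G : InfinitePlace L → ↥(arch (↥(maximalRealSubfield L)) L (IsCMField.complexConj L) 3 ((StdForm.antidiagonal 3).over L)) → ℂ := fun w a =>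
    InfinitePlace.Completion.extensionEmbedding w ((archLastRow L a 1).1 w) / InfinitePlace.Completion.extensionEmbedding w ((archLastRowL L a).1 w)
  let Fc : InfinitePlace L → ↥(arch (↥(maximalRealSubfield L)) L (IsCMField.complexConj L) 3 ((StdForm.antidiagonal 3).over L)) → ℂ := fun w a =>
    conj (InfinitePlace.Completion.extensionEmbedding w ((archLastRowS L a).1 w)) / conj (InfinitePlace.Completion.extensionEmbedding w ((archLastRowL L a).1 w))
  let Gc : InfinitePlace L → ↥(arch (↥(maximalRealSubfield L)) L (IsCMField.complexConj L) 3 ((StdForm.antidiagonal 3).over L)) → ℂ := fun w a =>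
    conj (InfinitePlace.Completion.extensionEmbedding w ((archLastRow L a 1).1 w)) / conj (InfinitePlace.Completion.extensionEmbedding w ((archLastRowL L a).1 w))
  -- the finitely generated `K_∞`-stable submodule `W`
  let W : Submodule ℂ (↥(arch (↥(maximalRealSubfield L)) L (IsCMField.complexConj L) 3 ((StdForm.antidiagonal 3).over L)) → ℂ) :=
    (∏ w : InfinitePlace L, Submodule.span ℂ ({F w, G w} : Set _) ^ p w * Submodule.span ℂ ({Fc w, Gc w} : Set _) ^ q w) *
      Submodule.span ℂ ({archSectionE L χ₁ χ₂} : Set _)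
  have hWfg : W.FG :=
    (fg_finset_prod _ _ fun w _ => ((Submodule.fg_span ((Set.finite_singleton _).insert _)).pow _).mul ((Submodule.fg_span ((Set.finite_singleton _).insert _)).pow _)).mul
      (Submodule.fg_span (Set.finite_singleton _))
  haveI : FiniteDimensional ℂ ↥W := (Submodule.fg_iff_finiteDimensional W).1 hWfg
  refine Submodule.finiteDimensional_of_le (S₂ := W) (Submodule.span_le.2 ?_)
  rintro _ ⟨⟨k, hk⟩, rfl⟩
  -- `W` is stable under right translation by `k`
  have hW : ∀ f ∈ W, (fun x => f (x * k)) ∈ W := by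
    refine precomp_mem_mul_of_forall k (precomp_mem_finset_prod_of_forall k _ _ fun w _ => precomp_mem_mul_of_forall k ?_ ?_) ?_
    · obtain ⟨α, β, γ, δ, h₁, h₂⟩ := exists_shiftRatio_laws_of_mem L k hk w
      exact precomp_mem_pow_of_forall k (fun f hf => precomp_mem_span_pair_of_laws k (F w) (G w) h₁ h₂ hf) _
    · obtain ⟨α, β, γ, δ, h₁, h₂⟩ := exists_shiftRatio_conj_laws_of_mem L k hk w
      exact precomp_mem_pow_of_forall k (fun f hf => precomp_mem_span_pair_of_laws k (Fc w) (Gc w) h₁ h₂ hf) _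
    · exact fun f hf => precomp_mem_span_singleton_of_mul k _ (fun a => archSectionE_mul_of_mem L χ₁ χ₂ a k hk) hf
  -- `Φ^{p,q} ∈ W`
  have hΦ : archSectionShifted L χ₁ χ₂ p q = (∏ w : InfinitePlace L, F w ^ p w * Fc w ^ q w) * archSectionE L χ₁ χ₂ := by
    funext a
    simp only [F, Fc, Pi.mul_apply, Finset.prod_apply, Pi.pow_apply, archSectionShifted_def, archShiftFactor_def]
  have hΦW : archSectionShifted L χ₁ χ₂ p q ∈ W := by
    rw [hΦ]
    exact Submodule.mul_mem_mul (finset_prod_mem_finset_prod _ _ fun w _ =>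
      Submodule.mul_mem_mul (Submodule.pow_mem_pow _ (Submodule.subset_span (Set.mem_insert _ _)) _)
        (Submodule.pow_mem_pow _ (Submodule.subset_span (Set.mem_insert _ _)) _)) (Submodule.subset_span rfl)
  exact hW _ hΦW

/-- **THE (V-τ) `IsArchFinite` INSTANCE**: every section `g ↦ Φ^{p,q}(g_∞)·Φf(g_f)` built on the shifted archimedean section is arch-finite (★ `isArchFinite_archFin_of_finiteDimensional` with its
`hΦ` paid by `finiteDimensional_span_archTranslates_archSectionShifted`). [cite: BorelJacquet1979, §1.3, §4.1] [cite: MoeglinWaldspurger1995, I.2.17] -/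
theorem isArchFinite_archSectionShifted_archFin (χ₁ : HeckeCharacter L) (χ₂ : ↥(TorusDict.torus (IsCMField.complexConj L)) →ₜ* ℂˣ) (p q : InfinitePlace L → ℕ)
    (Φf : ↥(finAdelic (↥(maximalRealSubfield L)) L (IsCMField.complexConj L) 3 ((StdForm.antidiagonal 3).over L)) → ℂ) :
    IsArchFinite L (fun g : (quasiSplit (↥(maximalRealSubfield L)) L (IsCMField.complexConj L) 3).Adelic =>
      archSectionShifted L χ₁ χ₂ p q (archPart (↥(maximalRealSubfield L)) L (IsCMField.complexConj L) 3 ((StdForm.antidiagonal 3).over L) g) *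
        Φf (finPart (↥(maximalRealSubfield L)) L (IsCMField.complexConj L) 3 ((StdForm.antidiagonal 3).over L) g)) :=
  isArchFinite_archFin_of_finiteDimensional L (archSectionShifted L χ₁ χ₂ p q) Φf (finiteDimensional_span_archTranslates_archSectionShifted L χ₁ χ₂ p q)

end Summit.HodgeConjecture.HodgeConjecture.R90.S8

end
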